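import Summits.QuantumFields.YangMills.Theorems.UnitScaleTiltProp7SectET3HessFormExplicitT3
import Literature.MathematicalPhysics.QuantumFieldTheory.Balaban1983to89.B9Eq310Hermitian
import HarnessLib

/-!
# Route `UnitScaleTilt`, crux «MinimiserStabilityRegPr» (stmt-QuantumFields-19200, stub EX), node N06(d = 3), route (α) — LAYER 0, ROWS (def-free), «Δ310-EXPLICIT» PARTS (C)+(D):
# **BRICK L0b's ABSTRACT WILSON HESSIAN `DeltaEta` IS PRINT'S (3.10) OPERATOR `η⁻²·(D¹*D¹_{U₀} + Δ′₁)` ON THE ROUTE CARRIER** — `DeltaEta U₀ (toL2 X) = toL2 (η⁻² • (deltaOp T U 1 (formComp X)))`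
# (lit ✓`B9Eq310Hermitian.deltaOp = divPη (curlη ·) + deltaPrimeOp`, EXACT background), **and the curvature part `Δ′₁` is `O(ε₀η²)` on the printed-regular class** (lit ✓`norm_deltaPrimeOp_le`),
# so FILE 2's displayed row `h310` (✓`Prop7SectET3HDeltaHOfRows`) IS INHABITED with `c₃₆₉ = 28`

Cell `ym3-torus`, width seat `ym3-torus-px5` (gen 0; FILL-TO-CAP «width 5»); EX-knit namer ★ym-ust-19200-w2 g5 GO (G6) 2026-08-28 16:51:55Z «px5: Δ310-EXPLICIT YES»; LOCATE memo
`HOME/ym3-torus-px5/LOCATE-DELTA310-EXPLICIT-px5.md` §3 (C)(D).  THEOREMS ONLY (0 `def`, 0 `sorry`); `--supports stmt-QuantumFields-19200 --as helper`; count-neutral.  YM₃ on T³ is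
ladder rung R3, NOT the Clay problem; nothing here is a claim about a stub, a crux, d = 4 or the mass gap; nothing of [Balaban1985BackgroundPropagators] §3 is asserted — the algebra and the
curvature letter are lit-balaban's kernel-checked rows READ at the member.

THE PRINT.  [Balaban1985BackgroundPropagators] (3.10) p. 392 *«⟨A, ΔA⟩ = ⟨A, D*DA⟩ + ⟨A, Δ′A⟩»* (the Hessian «given by the quadratic form», «hermitian operator»); [Balaban1985Variational]
p. 299 *«Δ = D*D + Δ′, Δ′ is a local, bounded operator satisfying the bound |Δ′HB|₍₋₃₎ ≦ O(ε₁)|B|»*.  Brick L0b: `⟪DeltaEta U₀ v, w⟫ = hessSesqRe U₀ v w = (−2c₀∕η²)·hessFormRe U₀ (star (toL2⁻¹v)) (toL2⁻¹w)`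
(✓`inner_DeltaEta_left`, ✓`hessSesqRe_apply`); part (B) §5: `hessFormRe U₀ X′ X` by polarization of `−hessPair T U 1 3 (½tr) ∘ formComp`; lit ✓`B9Eq310Hermitian.hessPair_add`:
`hessPair(A + B) = hessPair A + hessPair B + 2·bondPair A (deltaOp B)`, ✓`bondPair_deltaOp_symm`, ✓`star_deltaOp` (unitary background), ✓`norm_deltaPrimeOp_le`.

WHAT IS PROVED (member `F`, `n K`, weight `c₀`; `U₀ : GaugeField (F.P K) 0 SU(2)`; lit lattice `T := torusT (F.P K) 0`, `U := fun μ x ↦ bgUnits F K U₀ ⟨x,μ⟩`, `τ := ½tr`; ns `…Theorems.Prop7SectET3DeltaEtaExplicit`).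
* §1 letters: `formComp_add`, `formComp_star`, `sum_pbond_eq` (`Σ_{b : PBond} = Σ_x Σ_μ`), ★`val_inv_bgUnits_eq_star` (the background is unitary bondwise: lit's `hU`).
* §2 ★★`hessFormRe_eq_neg_bondPair_deltaOp` — THE BILINEAR LETTER AS A PAIRING: `hessFormRe U₀ X′ X = −bondPair 1 3 τ (formComp X′) (deltaOp T U 1 (formComp X))` ((B) §5 + ✓`hessPair_add`).
* §3 ★★★`DeltaEta_toL2_eq` — THE OPERATOR IDENTITY: `DeltaEta F n K c₀ U₀ (toL2 X) = toL2 (fun b ↦ (η⁻¹)² • deltaOp T U 1 (formComp X) b.dir b.src)` for EVERY `X` and every weight `c₀`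
  (`ext_inner_right`; the `½` of `τ` cancels the `2` of `hessSesqRe`, the `c₀` cancels against ✓`inner_toL2` — NO normalisation residue), and its reading ★★`symm_DeltaEta_toL2_apply`:
  `toL2⁻¹(Δ^η(toL2 X)) b = (η⁻¹)²•(covCodiffCurlT 1 (bgUnits U₀) X b.dir b.src + deltaPrimeOp T U 1 (formComp X) b.dir b.src)` (★px16 ✓`covCodiffCurlT_one_eq`) = print's `Δ^η = η⁻²(D¹*D¹ + Δ′₁)`.
* §4 (D) ★★`norm_deltaPrimeOp_le_of_regPr` — `RegPr F n K ε₀ U₀ → (∀ b, ‖X b‖ ≤ s) → ‖deltaPrimeOp T U 1 (formComp X) μ x‖ ≤ 28·(ε₀·η²)·s` (lit ✓`norm_deltaPrimeOp_le` with `δ := ε₀η²` from the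
  plaquette clause `‖U₀(∂p) − 1‖ ≤ ε₀η²` of `RegPr`, `‖Re W − 1‖, ‖Im W‖ ≤ ‖W − 1‖` for unitary `W`, `card (Fin 3) − 1 = 2`).
* §5 ★★★`h310_holds` — FILE 2's displayed row `h310` VERBATIM with `c₃₆₉ := 28`: `∀ X s, (∀ b, ‖X b‖ ≤ s) → ∀ b, ‖toL2⁻¹(Δ^η(toL2 X)) b − (η⁻¹)²•D¹*D¹_{U₀}X(b)‖ ≤ 28·ε₀·s` on `RegPr ε₀ U₀`.
HONEST SCOPE.  Bookkeeping over brick L0b, parts (A)(B), ★px16's dictionary and lit-balaban's landed (3.10) algebra∕letters; the only analytic input is lit's elementary sup letter for `Δ′`.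
Nothing of [B9] §3 ((3.42)∕(3.49)∕(3.126)); no positivity; nothing continuum ∕ OS ∕ mass-gap ∕ Clay.

References: T. Bałaban, CMP **99** (1985) 389–434 [Balaban1985BackgroundPropagators] ((3.8)–(3.12) pp.392, (3.69) p.404); CMP **102** (1985) 277–309 [Balaban1985Variational] ((14) p.280,
(19) p.281, (135)–(140) pp.298–299).
-/

set_option autoImplicit false

noncomputable section

open scoped Matrix.Norms.L2Operator BigOperators InnerProductSpace ComplexConjugate
open Complex (I)

namespace Summit.QuantumFields.YangMills.Theorems.Prop7SectET3DeltaEtaExplicit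

open Literature.MathematicalPhysics.QuantumFieldTheory.Balaban1983to89
open Literature.MathematicalPhysics.QuantumFieldTheory.Balaban1983to89.T3ContinuumYM3Torus
open Literature.MathematicalPhysics.QuantumFieldTheory.Balaban1983to89.T3PrintedRegularMinimiser (RegPr)
open Literature.MathematicalPhysics.QuantumFieldTheory.Balaban1983to89.T3RegularMinimiser (regThreshold)
open T3SectALandauChart (formComp bgUnits covCodiffCurlT eta eta_pos)
open B10Eq68TorusRegularity (plaqFT)
open B9TorusCalculus (torusT)
open B9Eq37Insertion (reC imC)
open B9Eq39Adjoint (curl plaqU bondPair hessPair)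
open B9Eq310Hermitian (deltaOp deltaPrimeOp zP yP hessPair_add bondPair_deltaOp_symm star_deltaOp plaqU_unitary norm_deltaPrimeOp_le)
open B11Eq103H1Complex (BondL2K)
open Summit.QuantumFields.YangMills.Theorems.Prop7SectET3Transport (periodsT3)
open Summit.QuantumFields.YangMills.Theorems.Prop7SectET3HilbertLetters (W₂ toL2 inner_toL2)
open Summit.QuantumFields.YangMills.Theorems.Prop7SectET3WilsonHessian (hessFormRe hessFormRe_symm DeltaEta hessSesqRe_apply inner_DeltaEta_left)
open Summit.QuantumFields.YangMills.Theorems.Prop7SectET3ActionQuad (halfTrace_comm halfTrace_apply')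
open Summit.QuantumFields.YangMills.Theorems.Prop7SectET3HessFormExplicit (hessFormRe_eq_polar_hessPair)
open Summit.QuantumFields.YangMills.Theorems.Prop7SecondOrderDict (covCodiffCurlT_one_eq norm_bgUnits_le_one norm_plaqFT_bgUnits_sub_one_le val_plaqU_torusT_eq_plaqFT)

variable {F : T3Family} {n K : ℕ} {c₀ : ℝ}

/-! ## §1 Letters -/

/-- `formComp` is additive (pointwise). [folklore] -/
theorem formComp_add (X Y : PBond (F.P K) 0 → Matrix (Fin 2) (Fin 2) ℂ) : formComp (X + Y) = formComp X + formComp Y := rfl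

/-- `formComp` commutes with the pointwise adjoint. [folklore] -/
theorem formComp_star (X : PBond (F.P K) 0 → Matrix (Fin 2) (Fin 2) ℂ) : formComp (star X) = star (formComp X) := rfl

/-- A sum over the member's bonds is the iterated sum over sites and directions. [folklore] -/
theorem sum_pbond_eq {M : Type*} [AddCommMonoid M] (f : PBond (F.P K) 0 → M) :
    ∑ b : PBond (F.P K) 0, f b = ∑ x : Site (F.P K) 0, ∑ μ : Fin (F.P K).d, f ⟨x, μ⟩ := by
  rw [← Fintype.sum_prod_type']
  exact (Fintype.sum_equiv ⟨fun b => (b.src, b.dir), fun p => ⟨p.1, p.2⟩, fun b => by cases b; rfl, fun p => rfl⟩ _ _ fun b => by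
    cases b; rfl)

/-- ★ **THE BACKGROUND IS UNITARY BONDWISE** (lit's hypothesis `hU`): `(U₀(b))⁻¹ = U₀(b)*` in the units of `M₂(ℂ)`. [cite: Balaban1985BackgroundPropagators, (3.5) p.391] -/
theorem val_inv_bgUnits_eq_star (U₀ : GaugeField (F.P K) 0 (Matrix.specialUnitaryGroup (Fin 2) ℂ)) (μ : Fin (F.P K).d) (x : Site (F.P K) 0) :
    ((((fun μ x => bgUnits F K U₀ ⟨x, μ⟩) μ x)⁻¹ : (Matrix (Fin 2) (Fin 2) ℂ)ˣ) : Matrix (Fin 2) (Fin 2) ℂ)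
      = star (((fun μ x => bgUnits F K U₀ ⟨x, μ⟩) μ x : (Matrix (Fin 2) (Fin 2) ℂ)ˣ) : Matrix (Fin 2) (Fin 2) ℂ) := by
  apply Units.inv_eq_of_mul_eq_one_right
  simp only [bgUnits, B10Eq27TorusAxialLog.val_unitsField]
  exact (B10Eq27TorusAxialLog.toUField U₀ ⟨x, μ⟩).2.2

/-! ## §2 The bilinear Hessian letter as lit's pairing against `deltaOp` -/

/-- ★★ **`hessFormRe U₀ X′ X = −bondPair 1 3 τ (formComp X′) (deltaOp T U 1 (formComp X))`** — brick L0b's bilinear Hessian IS MINUS print's pairing `⟨X′, ΔX⟩` of (3.10)∕(3.11) at unit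
spacing with the EXPLICIT operator `deltaOp = D¹*D¹ + Δ′₁` (lit), from (B) §5's polarization and ✓`hessPair_add`. [cite: Balaban1985BackgroundPropagators, (3.10)–(3.11) p.392] -/
theorem hessFormRe_eq_neg_bondPair_deltaOp (U₀ : GaugeField (F.P K) 0 (Matrix.specialUnitaryGroup (Fin 2) ℂ)) (X' X : PBond (F.P K) 0 → Matrix (Fin 2) (Fin 2) ℂ) :
    hessFormRe F K U₀ X' X
      = -bondPair 1 3 (((2 : ℂ)⁻¹ • LinearMap.toContinuousLinearMap (Matrix.traceLinearMap (Fin 2) ℂ ℂ)) : Matrix (Fin 2) (Fin 2) ℂ →ₗ[ℂ] ℂ)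
          (formComp X') (deltaOp (torusT (F.P K) 0) (fun μ x => bgUnits F K U₀ ⟨x, μ⟩) 1 (formComp X)) := by
  rw [hessFormRe_eq_polar_hessPair U₀ X' X, formComp_add,
    hessPair_add (torusT (F.P K) 0) (fun μ x => bgUnits F K U₀ ⟨x, μ⟩) _ halfTrace_comm 1 3 (formComp X') (formComp X)]
  ring

/-! ## §3 The operator identity -/

/-- ★★★ **THE OPERATOR IDENTITY: `DeltaEta U₀ (toL2 X) = toL2 (η⁻² • deltaOp T U 1 (formComp X))`** — brick L0b's abstract Wilson Hessian (the Riesz operator of the second Fréchet derivative of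
`actionRe ∘ chartU U₀`) IS print's explicit (3.10) operator `η⁻²(D¹*D¹_{U₀} + Δ′₁)` (lit ✓`B9Eq310Hermitian.deltaOp` at unit spacing, read on the route carrier), for EVERY exponent field `X`,
every background `U₀ ∈ SU(2)^{bonds}` and every pairing weight `c₀ > 0`. [cite: Balaban1985BackgroundPropagators, (3.10)–(3.12) p.392] -/
theorem DeltaEta_toL2_eq [Fact (0 < c₀)] (U₀ : GaugeField (F.P K) 0 (Matrix.specialUnitaryGroup (Fin 2) ℂ)) (X : PBond (F.P K) 0 → Matrix (Fin 2) (Fin 2) ℂ) :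
    DeltaEta F n K c₀ U₀ (toL2 F K c₀ X)
      = toL2 F K c₀ (fun b : PBond (F.P K) 0 => ((((eta F n K)⁻¹ ^ 2 : ℝ) : ℂ)) •
          deltaOp (torusT (F.P K) 0) (fun μ x => bgUnits F K U₀ ⟨x, μ⟩) 1 (formComp X) b.dir b.src) := by
  set T := torusT (F.P K) 0 with hT
  set U : Fin (F.P K).d → Site (F.P K) 0 → (Matrix (Fin 2) (Fin 2) ℂ)ˣ := fun μ x => bgUnits F K U₀ ⟨x, μ⟩ with hU
  set τ : Matrix (Fin 2) (Fin 2) ℂ →ₗ[ℂ] ℂ :=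
    (((2 : ℂ)⁻¹ • LinearMap.toContinuousLinearMap (Matrix.traceLinearMap (Fin 2) ℂ ℂ)) : Matrix (Fin 2) (Fin 2) ℂ →ₗ[ℂ] ℂ) with hτ_def
  have hτ : ∀ a b : Matrix (Fin 2) (Fin 2) ℂ, τ (a * b) = τ (b * a) := fun a b => by rw [hτ_def]; exact halfTrace_comm a b
  have hUu : ∀ μ x, (((U μ x)⁻¹ : (Matrix (Fin 2) (Fin 2) ℂ)ˣ) : Matrix (Fin 2) (Fin 2) ℂ) = star (U μ x : Matrix (Fin 2) (Fin 2) ℂ) :=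
    fun μ x => by rw [hU]; exact val_inv_bgUnits_eq_star U₀ μ x
  have hη : (eta F n K : ℝ) ≠ 0 := (eta_pos F n K).ne'
  -- test against `toL2 X'`
  refine ext_inner_right ℂ fun w => ?_
  obtain ⟨X', rfl⟩ := (toL2 F K c₀).surjective w
  -- LHS: `⟪Δ(toL2 X), toL2 X'⟫ = (−2c₀∕η²)·hessFormRe (star X) X' = (2c₀∕η²)·bondPair (formComp X') (deltaOp (formComp (star X)))`
  rw [inner_DeltaEta_left, hessSesqRe_apply, LinearEquiv.symm_apply_apply, LinearEquiv.symm_apply_apply, hessFormRe_eq_neg_bondPair_deltaOp,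
    ← hT, ← hU, ← hτ_def, ← bondPair_deltaOp_symm T U τ hτ, formComp_star]
  -- `deltaOp (star A) = star ∘ deltaOp A` (unitary background)
  have hstar : deltaOp T U 1 (star (formComp X)) = fun μ x => star (deltaOp T U 1 (formComp X) μ x) := by
    funext μ x; rw [star_deltaOp T U hUu]
  rw [hstar, bondPair, inner_toL2, sum_pbond_eq]
  have hκ : star ((((eta F n K)⁻¹ ^ 2 : ℝ) : ℂ)) = (((eta F n K)⁻¹ ^ 2 : ℝ) : ℂ) := Complex.conj_ofReal _
  -- per bond: `τ(X′·(ΔX)*) = ½tr((ΔX)ᴴ·X′)`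
  have hper : ∀ (x : Site (F.P K) 0) (μ : Fin (F.P K).d),
      τ (formComp X' μ x * star (deltaOp T U 1 (formComp X) μ x))
        = 2⁻¹ * Matrix.trace ((deltaOp T U 1 (formComp X) μ x).conjTranspose * X' ⟨x, μ⟩) := by
    intro x μ
    rw [hτ_def, halfTrace_apply', Matrix.star_eq_conjTranspose, Matrix.trace_mul_comm]
    rfl
  simp only [hper, Matrix.conjTranspose_smul, hκ, Matrix.smul_mul, Matrix.trace_smul, smul_eq_mul, ← Finset.mul_sum, Complex.ofReal_one, one_pow,
    one_mul]
  -- the scalar bookkeeping `(−2c₀∕η²)·(−½) = c₀·η⁻²`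
  push_cast
  field_simp

/-- ★★ **THE READING IN THE `nMax19` LETTERS**: `toL2⁻¹(Δ^η(toL2 X))(b) = (η⁻¹)² • ((D¹*_{U₀}D¹_{U₀}X)_{b} + (Δ′₁X)_{b})` — print's `Δ = D*D + Δ′` ([Balaban1985Variational] p.299) with
`D^η = η⁻¹D¹`, the `D*D` member being EXACTLY `nMax19`'s `covCodiffCurlT 1 (bgUnits U₀)` (★px16 ✓`covCodiffCurlT_one_eq`) and `Δ′₁` lit's explicit local operator `deltaPrimeOp`.
[cite: Balaban1985BackgroundPropagators, (3.10) p.392; Balaban1985Variational, (19) p.281, p.299] -/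
theorem symm_DeltaEta_toL2_apply [Fact (0 < c₀)] (U₀ : GaugeField (F.P K) 0 (Matrix.specialUnitaryGroup (Fin 2) ℂ)) (X : PBond (F.P K) 0 → Matrix (Fin 2) (Fin 2) ℂ)
    (b : PBond (F.P K) 0) :
    (toL2 F K c₀).symm (DeltaEta F n K c₀ U₀ (toL2 F K c₀ X)) b
      = ((((eta F n K)⁻¹ ^ 2 : ℝ) : ℂ)) •
          (covCodiffCurlT 1 (bgUnits F K U₀) X b.dir b.src
            + deltaPrimeOp (torusT (F.P K) 0) (fun μ x => bgUnits F K U₀ ⟨x, μ⟩) 1 (formComp X) b.dir b.src) := by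
  have hcurl : B9Eq39Adjoint.curlη (torusT (F.P K) 0) (fun μ x => bgUnits F K U₀ ⟨x, μ⟩) 1 (formComp X)
      = curl (torusT (F.P K) 0) (fun μ x => bgUnits F K U₀ ⟨x, μ⟩) (formComp X) := by
    funext μ ν x
    rw [B9Eq39Adjoint.curlη, Complex.ofReal_one, inv_one, one_smul]
  rw [DeltaEta_toL2_eq, LinearEquiv.symm_apply_apply, deltaOp, B9Eq39Adjoint.divPη, hcurl, covCodiffCurlT_one_eq, Complex.ofReal_one, inv_one, one_smul]

/-! ## §4 (D): the curvature part is `O(ε₀η²)` on the printed-regular class -/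

/-- ★★ **`‖(Δ′₁X)(b)‖ ≤ 28·(ε₀η²)·sup‖X‖` ON `RegPr F n K ε₀ U₀`** — print's «Δ′ is a local, bounded operator, |Δ′HB| ≦ O(ε₁)|B|» at the member, from lit's elementary sup letter ✓`norm_deltaPrimeOp_le`
(`14·(a·δ)·(card ι − 1)`, `card (Fin 3) − 1 = 2`) with `δ := ε₀η²`: the weights `η⁻²(Re W_p − 1)`, `η⁻² Im W_p` at unit spacing are bounded by `‖W_p − 1‖ ≤ ε₀η²` (the plaquette clause
of `RegPr`, ★px16 ✓`norm_plaqFT_bgUnits_sub_one_le`; `W_p⁻¹ = W_p*` by ✓`plaqU_unitary`). [cite: Balaban1985Variational, (14) p.280, p.299; Balaban1985BackgroundPropagators, (3.10) p.392] -/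
theorem norm_deltaPrimeOp_le_of_regPr {ε₀ : ℝ} (U₀ : GaugeField (F.P K) 0 (Matrix.specialUnitaryGroup (Fin 2) ℂ)) (hreg : RegPr F n K ε₀ U₀)
    {X : PBond (F.P K) 0 → Matrix (Fin 2) (Fin 2) ℂ} {s : ℝ} (hX : ∀ b, ‖X b‖ ≤ s) (μ : Fin (F.P K).d) (x : Site (F.P K) 0) :
    ‖deltaPrimeOp (torusT (F.P K) 0) (fun μ x => bgUnits F K U₀ ⟨x, μ⟩) 1 (formComp X) μ x‖ ≤ 28 * (ε₀ * eta F n K ^ 2) * s := by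
  set T := torusT (F.P K) 0 with hT
  set U : Fin (F.P K).d → Site (F.P K) 0 → (Matrix (Fin 2) (Fin 2) ℂ)ˣ := fun μ x => bgUnits F K U₀ ⟨x, μ⟩ with hU
  have hU1 : ∀ μ x, ‖(U μ x : Matrix (Fin 2) (Fin 2) ℂ)‖ ≤ 1 ∧ ‖(((U μ x)⁻¹ : (Matrix (Fin 2) (Fin 2) ℂ)ˣ) : Matrix (Fin 2) (Fin 2) ℂ)‖ ≤ 1 :=
    fun μ x => norm_bgUnits_le_one F K U₀ ⟨x, μ⟩
  have hUu : ∀ μ x, (((U μ x)⁻¹ : (Matrix (Fin 2) (Fin 2) ℂ)ˣ) : Matrix (Fin 2) (Fin 2) ℂ) = star (U μ x : Matrix (Fin 2) (Fin 2) ℂ) :=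
    fun μ x => by rw [hU]; exact val_inv_bgUnits_eq_star U₀ μ x
  have hA : ∀ μ x, ‖formComp X μ x‖ ≤ s := fun μ x => hX ⟨x, μ⟩
  -- the plaquette clause of `RegPr`: `‖W_p − 1‖ ≤ ε₀η²` (both orientations)
  have hδ : regThreshold F n K ε₀ = ε₀ * eta F n K ^ 2 := by
    rw [regThreshold, eta, ← pow_mul, mul_comm 2 (K - n)]
  have hW : ∀ μ ν y, μ < ν → ‖(plaqU T U μ ν y : Matrix (Fin 2) (Fin 2) ℂ) - 1‖ ≤ ε₀ * eta F n K ^ 2 := by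
    intro μ ν y hμν
    rw [hT, hU, val_plaqU_torusT_eq_plaqFT, ← hδ]
    exact norm_plaqFT_bgUnits_sub_one_le F K U₀ hreg.plaqSmall μ ν y hμν.ne
  have hWinv : ∀ μ ν y, μ < ν → ‖(((plaqU T U μ ν y)⁻¹ : (Matrix (Fin 2) (Fin 2) ℂ)ˣ) : Matrix (Fin 2) (Fin 2) ℂ) - 1‖ ≤ ε₀ * eta F n K ^ 2 := by
    intro μ ν y hμν
    rw [plaqU_unitary T U hUu, ← star_one (R := Matrix (Fin 2) (Fin 2) ℂ), ← star_sub, norm_star]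
    exact hW μ ν y hμν
  have hz : ∀ μ ν y, μ < ν → ‖zP T U 1 μ ν y‖ ≤ ε₀ * eta F n K ^ 2 := by
    intro μ ν y hμν
    rw [zP, Complex.ofReal_one, inv_one, one_pow, one_smul, reC]
    have hrw : (2 : ℂ)⁻¹ • ((plaqU T U μ ν y : Matrix (Fin 2) (Fin 2) ℂ) + (((plaqU T U μ ν y)⁻¹ : (Matrix (Fin 2) (Fin 2) ℂ)ˣ) : Matrix (Fin 2) (Fin 2) ℂ)) - 1
        = (2 : ℂ)⁻¹ • (((plaqU T U μ ν y : Matrix (Fin 2) (Fin 2) ℂ) - 1) + ((((plaqU T U μ ν y)⁻¹ : (Matrix (Fin 2) (Fin 2) ℂ)ˣ) : Matrix (Fin 2) (Fin 2) ℂ) - 1)) := by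
      rw [smul_add, smul_add, smul_sub, smul_sub]
      have h2 : (2 : ℂ)⁻¹ • (1 : Matrix (Fin 2) (Fin 2) ℂ) + (2 : ℂ)⁻¹ • (1 : Matrix (Fin 2) (Fin 2) ℂ) = 1 := by
        rw [← add_smul]; norm_num
      linear_combination (norm := module) -h2
    rw [hrw, norm_smul]
    have hhalf : ‖(2 : ℂ)⁻¹‖ = 2⁻¹ := by simp
    rw [hhalf]
    calc 2⁻¹ * ‖((plaqU T U μ ν y : Matrix (Fin 2) (Fin 2) ℂ) - 1) + ((((plaqU T U μ ν y)⁻¹ : (Matrix (Fin 2) (Fin 2) ℂ)ˣ) : Matrix (Fin 2) (Fin 2) ℂ) - 1)‖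
        ≤ 2⁻¹ * (ε₀ * eta F n K ^ 2 + ε₀ * eta F n K ^ 2) := by
          gcongr
          exact (norm_add_le _ _).trans (add_le_add (hW μ ν y hμν) (hWinv μ ν y hμν))
      _ = ε₀ * eta F n K ^ 2 := by ring
  have hy : ∀ μ ν y, μ < ν → ‖yP T U 1 μ ν y‖ ≤ ε₀ * eta F n K ^ 2 := by
    intro μ ν y hμν
    rw [yP, Complex.ofReal_one, inv_one, one_pow, one_smul, B9Eq37Insertion.imC_eq]
    have hrw : ((plaqU T U μ ν y : Matrix (Fin 2) (Fin 2) ℂ) - (((plaqU T U μ ν y)⁻¹ : (Matrix (Fin 2) (Fin 2) ℂ)ˣ) : Matrix (Fin 2) (Fin 2) ℂ))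
        = ((plaqU T U μ ν y : Matrix (Fin 2) (Fin 2) ℂ) - 1) - ((((plaqU T U μ ν y)⁻¹ : (Matrix (Fin 2) (Fin 2) ℂ)ˣ) : Matrix (Fin 2) (Fin 2) ℂ) - 1) := by
      abel
    rw [hrw, norm_smul]
    have hhalf : ‖(-(I / 2) : ℂ)‖ = 2⁻¹ := by simp
    rw [hhalf]
    calc 2⁻¹ * ‖((plaqU T U μ ν y : Matrix (Fin 2) (Fin 2) ℂ) - 1) - ((((plaqU T U μ ν y)⁻¹ : (Matrix (Fin 2) (Fin 2) ℂ)ˣ) : Matrix (Fin 2) (Fin 2) ℂ) - 1)‖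
        ≤ 2⁻¹ * (ε₀ * eta F n K ^ 2 + ε₀ * eta F n K ^ 2) := by
          gcongr
          exact (norm_sub_le _ _).trans (add_le_add (hW μ ν y hμν) (hWinv μ ν y hμν))
      _ = ε₀ * eta F n K ^ 2 := by ring
  have h := norm_deltaPrimeOp_le T U hU1 hA hz hy μ x
  have hcard : ((Fintype.card (Fin (F.P K).d) - 1 : ℕ) : ℝ) = 2 := by
    rw [Fintype.card_fin, T3Family.P_d]; norm_num
  rw [hcard] at h
  linarith

/-! ## §5 FILE 2's displayed row `h310`, inhabited -/

/-- ★★★ **THE ROW `h310` OF ✓`Prop7SectET3HDeltaHOfRows.hΔH_of_rows` IS A THEOREM, `c₃₆₉ = 28`**: on `RegPr F n K ε₀ U₀`, for every one-form `X` with `‖X b‖ ≤ s`,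
`‖toL2⁻¹(Δ^η(toL2 X))(b) − (η⁻¹)² • (D¹*_{U₀}D¹_{U₀}X)_b‖ ≤ 28·ε₀·s` — print's (3.10) + «|Δ′HB|₍₋₃₎ ≦ O(ε₁)|B|» for brick L0b's `DeltaEta`. [cite: Balaban1985Variational, p.299; Balaban1985BackgroundPropagators, (3.10) p.392] -/
theorem h310_holds [Fact (0 < c₀)] {ε₀ : ℝ} (U₀ : GaugeField (F.P K) 0 (Matrix.specialUnitaryGroup (Fin 2) ℂ)) (hreg : RegPr F n K ε₀ U₀) :
    ∀ (X : PBond (F.P K) 0 → Matrix (Fin 2) (Fin 2) ℂ) (s : ℝ), (∀ b, ‖X b‖ ≤ s) → ∀ b : PBond (F.P K) 0,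
      ‖(toL2 F K c₀).symm (DeltaEta F n K c₀ U₀ (toL2 F K c₀ X)) b
          - ((((eta F n K)⁻¹ ^ 2 : ℝ) : ℂ)) • covCodiffCurlT 1 (bgUnits F K U₀) X b.dir b.src‖ ≤ 28 * ε₀ * s := by
  intro X s hX b
  have hη : 0 < eta F n K := eta_pos F n K
  rw [symm_DeltaEta_toL2_apply, smul_add, add_sub_cancel_left, norm_smul]
  have hκ : ‖((((eta F n K)⁻¹ ^ 2 : ℝ) : ℂ))‖ = (eta F n K)⁻¹ ^ 2 := by
    rw [Complex.norm_real, Real.norm_of_nonneg (by positivity)]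
  rw [hκ]
  have h := norm_deltaPrimeOp_le_of_regPr U₀ hreg hX b.dir b.src
  calc (eta F n K)⁻¹ ^ 2 * ‖deltaPrimeOp (torusT (F.P K) 0) (fun μ x => bgUnits F K U₀ ⟨x, μ⟩) 1 (formComp X) b.dir b.src‖
      ≤ (eta F n K)⁻¹ ^ 2 * (28 * (ε₀ * eta F n K ^ 2) * s) := mul_le_mul_of_nonneg_left h (by positivity)
    _ = 28 * ε₀ * s := by field_simp

end Summit.QuantumFields.YangMills.Theorems.Prop7SectET3DeltaEtaExplicit

end
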